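import Summits.ResolutionOfSingularities.ResolutionOfSingularities.Theorems.UniversalCellsMatroidCellResChartReduction
import HarnessLib

/-!
# `MatroidCellRes` ⇔ its saturated-chart form (crux `UniversalCells.MatroidCellRes`, line `birth`)

Support file for crux item `stmt-ResolutionOfSingularities-15230` (lead prover, continuation c3).

`Theorems/UniversalCellsMatroidCellResChartReduction.lean` proved the crux from a CHART ENGINE that
resolves every saturated integral principal affine chart `Spec (Q_Γ)_g` of a Γ-scheme GLOBALLY.
Here the reduction is sharpened to an EQUIVALENCE: the crux `MatroidCellRes` (all primes `p`, all
`m`, all partial matroid strata `P(p,m,Γ₊,Γ₀)`, all integral `W` open-immersed in a stratum, local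
resolvability at every point of `W`) is EQUIVALENT to the same pointwise-local resolvability for
the saturated integral principal affine charts `Spec (Q_Γ)_g` alone
(`matroidCellRes_iff_chartLocallyResolvable`):

* `⇒` (`chartLocallyResolvable_of_matroidCellRes`): `Spec (Q_Γ)_g` is itself an integral scheme
  open-immersed in the stratum `P(p,m,∅,Γ)` — the localisation `Q_Γ → (Q_Γ)_g` is an open
  immersion on spectra and `Q_Γ ≅ S(p,m,∅,Γ) = (Q_Γ)_1` (localisation at a unit); saturation is
  not even needed;
* `⇐` (`matroidCellRes_of_chartLocallyResolvable`): as in `matroidCellRes_of_chartEngine` — the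
  glue stubs `stub_affineNbhd`, `stub_saturateAway` put an open `U ∋ w` of `W` inside a saturated
  integral chart `Spec (Q_Γ)_g` by an open immersion `φ`; a resolvable open `W'' ∋ φ(w)` of the chart
  pulls back to the resolvable open `φ⁻¹ W''` of `U` (restriction of `φ` is an open immersion),
  whose image in `W` is the neighbourhood.

Consequently the registered residue stub (N) `stub_saturatedEngineNonintegral` of `Lines/birth.lean`
may be weakened from GLOBAL resolution of the chart to POINTWISE-LOCAL resolvability without losing
the composition, and in that local form "(H) ∧ (N)" is not merely sufficient for the crux but a
PARTITION of an equivalent of it (by whether `Q_Γ` is a domain): nothing is lost by promoting (N).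

No new definitions (the chart form is spelled out; `tautMatrix` / `minorIdeal` / `StratumRing` are
the reducible abbreviations of `Theorems/UniversalCellsDefs.lean`).
-/

noncomputable section

-- single-problem summit: the doubled namespace component `ResolutionOfSingularities` is forced
set_option linter.dupNamespace false

open CategoryTheory AlgebraicGeometry Literature.AlgebraicGeometry.Resolution
open Summit.ResolutionOfSingularities.ResolutionOfSingularities.Theses.UniversalCells (MatroidCellRes)
open Summit.ResolutionOfSingularities.ResolutionOfSingularities.Theorems.UniversalCells
  (tautMatrix minorIdeal StratumRing)

namespace Summit.ResolutionOfSingularities.ResolutionOfSingularities.Theorems.MatroidCellRes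

/-- **Crux ⇒ chart form.** Under `MatroidCellRes`, every integral principal affine chart
`Spec (Q_Γ)_g` of a Γ-scheme over `𝔽_p` is pointwise-locally resolvable: it is an integral scheme
open-immersed in the stratum `P(p,m,∅,Γ) = Spec (Q_Γ)_1` (composite of the localisation open
immersion `Spec (Q_Γ)_g → Spec Q_Γ` with the isomorphism `Spec Q_Γ ≅ Spec (Q_Γ)_1`). [folklore] -/
theorem chartLocallyResolvable_of_matroidCellRes (h : MatroidCellRes)
    (p : ℕ) (hp : p.Prime) (m : ℕ) (Γ : Set (Fin 3 → Fin 3 ⊕ Fin m))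
    (g : MvPolynomial (Fin 3 × Fin m) (ZMod p) ⧸ minorIdeal p m Γ)
    (hdom : IsDomain (Localization.Away g)) (w : Spec (.of (Localization.Away g))) :
    ∃ W' : (Spec (.of (Localization.Away g))).Opens,
      w ∈ W' ∧ Scheme.HasResolution (W' : Scheme.{0}) := by
  classical
  haveI := hdom
  -- `Q_Γ ≅ S(p,m,∅,Γ)`, the localisation of `Q_Γ` away from the unit `∏_{u ∈ ∅} x_u = 1`
  have hs : IsUnit (Ideal.Quotient.mk (minorIdeal p m Γ)
      (∏ u ∈ (∅ : Finset (Fin 3 → Fin 3 ⊕ Fin m)), ((tautMatrix p m).submatrix id u).det)) := by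
    rw [Finset.prod_empty, map_one]
    exact isUnit_one
  let eAlg : (MvPolynomial (Fin 3 × Fin m) (ZMod p) ⧸ minorIdeal p m Γ) ≃ₐ[
      MvPolynomial (Fin 3 × Fin m) (ZMod p) ⧸ minorIdeal p m Γ] StratumRing p m ∅ Γ :=
    IsLocalization.atUnits (MvPolynomial (Fin 3 × Fin m) (ZMod p) ⧸ minorIdeal p m Γ)
      (Submonoid.powers (Ideal.Quotient.mk (minorIdeal p m Γ)
        (∏ u ∈ (∅ : Finset (Fin 3 → Fin 3 ⊕ Fin m)), ((tautMatrix p m).submatrix id u).det)))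
      (Submonoid.powers_le.mpr hs)
  let ιS : Spec (.of (MvPolynomial (Fin 3 × Fin m) (ZMod p) ⧸ minorIdeal p m Γ)) ⟶
      Spec (.of (StratumRing p m ∅ Γ)) :=
    Spec.map eAlg.symm.toRingEquiv.toCommRingCatIso.hom
  haveI : IsIso ιS := inferInstance
  -- the localisation open immersion `Spec (Q_Γ)_g → Spec Q_Γ`
  let ιT : Spec (.of (Localization.Away g)) ⟶
      Spec (.of (MvPolynomial (Fin 3 × Fin m) (ZMod p) ⧸ minorIdeal p m Γ)) :=
    Spec.map (CommRingCat.ofHom (algebraMap _ (Localization.Away g)))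
  haveI : IsOpenImmersion ιT := IsOpenImmersion.of_isLocalization g
  have hi : IsOpenImmersion (ιT ≫ ιS) := inferInstance
  have hW : IsIntegral (Spec (.of (Localization.Away g))) := inferInstance
  exact h p hp m ∅ Γ (Spec (.of (Localization.Away g))) (ιT ≫ ιS) hi hW w

/-- **Chart form ⇒ crux.** If every SATURATED INTEGRAL PRINCIPAL AFFINE CHART `Spec (Q_Γ)_g` of a
Γ-scheme over `𝔽_p` (`(Q_Γ)_g` a domain, `u ∉ Γ ⇒ x_u ≠ 0 in (Q_Γ)_g`) is POINTWISE-LOCALLY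
resolvable, then `MatroidCellRes` holds: the glue stubs `stub_affineNbhd`, `stub_saturateAway`
give an open `U ∋ w` of `W` with an open immersion `φ : U → Spec (Q_Γ)_g` into such a chart; a
resolvable open `W'' ∋ φ(w)` of the chart restricts to the resolvable open `φ⁻¹ W''` of `U`
(`φ ∣_ W''` is an open immersion), and its image `U.ι(φ⁻¹ W'') ≅ φ⁻¹ W''` is the neighbourhood
of `w` in `W`. Sharpens `matroidCellRes_of_chartEngine` (global resolution of the chart).
[folklore] -/
theorem matroidCellRes_of_chartLocallyResolvable
    (hC : ∀ p : ℕ, p.Prime → ∀ (m : ℕ) (Γ : Set (Fin 3 → Fin 3 ⊕ Fin m))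
      (g : MvPolynomial (Fin 3 × Fin m) (ZMod p) ⧸ minorIdeal p m Γ),
      IsDomain (Localization.Away g) →
        (∀ u : Fin 3 → Fin 3 ⊕ Fin m, u ∉ Γ →
          algebraMap (MvPolynomial (Fin 3 × Fin m) (ZMod p) ⧸ minorIdeal p m Γ)
            (Localization.Away g)
            (Ideal.Quotient.mk (minorIdeal p m Γ) ((tautMatrix p m).submatrix id u).det) ≠ 0) →
        ∀ w : Spec (.of (Localization.Away g)),
          ∃ W' : (Spec (.of (Localization.Away g))).Opens,
            w ∈ W' ∧ Scheme.HasResolution (W' : Scheme.{0})) :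
    MatroidCellRes := by
  intro p hp m Γp Γ0 M I W i hi hW w
  classical
  haveI : Fact p.Prime := ⟨hp⟩
  haveI : IsOpenImmersion i := hi
  -- the localisation open immersion `P(p,m,Γ₊,Γ₀) → Z_{Γ₀}` and the composite `W → Z_{Γ₀}`
  let ιP : Spec (.of (StratumRing p m Γp Γ0)) ⟶
      Spec (.of (MvPolynomial (Fin 3 × Fin m) (ZMod p) ⧸ minorIdeal p m Γ0)) :=
    Spec.map (CommRingCat.ofHom (algebraMap (MvPolynomial (Fin 3 × Fin m) (ZMod p) ⧸
      minorIdeal p m Γ0) (StratumRing p m Γp Γ0)))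
  haveI : IsOpenImmersion ιP :=
    IsOpenImmersion.of_isLocalization
      (Ideal.Quotient.mk (minorIdeal p m Γ0) (∏ u ∈ Γp, ((tautMatrix p m).submatrix id u).det))
  have hj : IsOpenImmersion (i ≫ ιP) := inferInstance
  -- an integral principal affine chart around `w`, saturated
  obtain ⟨f, U, e, hwU, he, hdomf⟩ := stub_affineNbhd p m Γ0 W (i ≫ ιP) hj hW w
  obtain ⟨Γ, g, eRing, hdomg, hsat⟩ := stub_saturateAway p m Γ0 f hdomf
  let ι : Spec (.of (Localization.Away f)) ⟶ Spec (.of (Localization.Away g)) :=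
    Spec.map (eRing.symm.toCommRingCatIso).hom
  haveI : IsIso ι := inferInstance
  haveI : IsOpenImmersion e := he
  haveI hφ : IsOpenImmersion (e ≫ ι) := inferInstance
  -- a resolvable open of the saturated chart around the image of `w`
  obtain ⟨W'', hxW'', hres⟩ := hC p hp m Γ g hdomg hsat ((e ≫ ι).base ⟨w, hwU⟩)
  -- pull it back to `U` (restriction of the open immersion `e ≫ ι`) …
  have hV : Scheme.HasResolution (((e ≫ ι) ⁻¹ᵁ W'' : (U : Scheme.{0}).Opens) : Scheme.{0}) :=
    Scheme.HasResolution.of_isOpenImmersion ((e ≫ ι) ∣_ W'') hres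
  -- … and push it into `W` along `U.ι`
  refine ⟨U.ι ''ᵁ ((e ≫ ι) ⁻¹ᵁ W''), ⟨⟨w, hwU⟩, hxW'', rfl⟩, ?_⟩
  exact Scheme.HasResolution.of_isOpenImmersion (U.ι.isoImage ((e ≫ ι) ⁻¹ᵁ W'')).inv hV

/-- **`MatroidCellRes` ⇔ its saturated-chart form.** The crux is EQUIVALENT to: for every prime
`p`, every `m`, every set of column triples `Γ` and every `g ∈ Q_Γ = 𝔽_p[a_ij : 3 × m] ⧸ (x_u, u ∈ Γ)`
with `(Q_Γ)_g` a domain and `Γ` saturated on the chart (`u ∉ Γ ⇒ x_u ≠ 0 in (Q_Γ)_g`), every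
point of `Spec (Q_Γ)_g` has an open neighbourhood admitting a resolution of singularities. The
partial matroid strata, `Γ₊`, the integral scheme `W` and its open immersion have all disappeared;
Hu's Theorem 1.3 [cite: Hu2025, Thm. 1.3 (p. 8)] is the sub-case `Q_Γ` a domain (then `Γ` is
automatically saturated on every non-empty chart), and the registered residue (N) of line `birth`
is the sub-case `Q_Γ` not a domain. [folklore] -/
theorem matroidCellRes_iff_chartLocallyResolvable :
    MatroidCellRes ↔
      ∀ p : ℕ, p.Prime → ∀ (m : ℕ) (Γ : Set (Fin 3 → Fin 3 ⊕ Fin m))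
        (g : MvPolynomial (Fin 3 × Fin m) (ZMod p) ⧸ minorIdeal p m Γ),
        IsDomain (Localization.Away g) →
          (∀ u : Fin 3 → Fin 3 ⊕ Fin m, u ∉ Γ →
            algebraMap (MvPolynomial (Fin 3 × Fin m) (ZMod p) ⧸ minorIdeal p m Γ)
              (Localization.Away g)
              (Ideal.Quotient.mk (minorIdeal p m Γ) ((tautMatrix p m).submatrix id u).det) ≠ 0) →
          ∀ w : Spec (.of (Localization.Away g)),
            ∃ W' : (Spec (.of (Localization.Away g))).Opens,
              w ∈ W' ∧ Scheme.HasResolution (W' : Scheme.{0}) :=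
  ⟨fun h p hp m Γ g hdom _ w => chartLocallyResolvable_of_matroidCellRes h p hp m Γ g hdom w,
    matroidCellRes_of_chartLocallyResolvable⟩

end Summit.ResolutionOfSingularities.ResolutionOfSingularities.Theorems.MatroidCellRes

end
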